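import Literature.MathematicalPhysics.QuantumFieldTheory.Balaban1983to89.B9Eq3194Derivative
import Literature.MathematicalPhysics.QuantumFieldTheory.Balaban1983to89.B7Prop3GeneralLinearBound

/-!
# `Balaban1983to89.B9Eq3194LinearTerm` — T. Bałaban, *Propagators for lattice gauge theories in a background field*,
# Commun. Math. Phys. **99** (1985) 389–434 [Balaban1985BackgroundPropagators], Appendix p. 433, (3.194)
# «Q_j(U)A = Q′_jA + F_{2,j}(U)A, where the operator F_{2,j}(U) is small» — THE LEVEL-BY-LEVEL ESTIMATES behind the
# smallness of `F_{2,j}(U)`: one step of (78) of [5] linearised at a general regular point is the block mean up to `O(ε)`, and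
# the tower bounds — file 2 of 3 of the row `B9.App` display (3.194) (file 1: `B9Eq3194Derivative`, the linear term; file 3:
# `B9Eq3194Smallness`, the bound on `F_{2,j}(U)` itself)

statement-level skeleton of published theorems with citation tags; proofs where landed; nothing here is a claim about the Yang–Mills mass gap

PDF held: `paper:balaban1985-cmp99-background-propagators` (journal page = PDF page + 388); render
`run/shared/lean/pub/pub-balaban/b2b-balaban-ref1/pages/1985-cmp99-background-propagators/1985-cmp99-background-propagators-p045-x2.png`
(p. 433, READ AS AN IMAGE by this seat, 2026-08-21); [5] = [Balaban1985Averaging] (78)–(80) p. 30, (167) p. 44 through the tree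
modules quoted in file 1.

CITATION HEADER (lean-in-tree rule) / WHAT IS REPRODUCED.  lit-balaban SKELETON row `B9.App`, display (3.194) p. 433 (PRINT,
verbatim: "and expanding in A, we can easily see that for the linear term we have Q_j(U)A = Q′_jA + F_{2,j}(U)A, (3.194) where the
operator F_{2,j}(U) is small."; p. 433 also: "We consider only regular background fields U").  No constant is printed; this file
supplies one.

WHAT THIS FILE PROVES (kernel, no `sorry`, standard axioms; objects of file 1: `stepLam`, `lamTower`, `linQj`, `F2`; `𝔸` any
complete normed `ℂ`-algebra with `‖1‖ = 1`, values of the background in `U1` (`‖u‖, ‖u⁻¹‖ ≤ 1`, e.g. unitary)):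
* §1 `norm_stepLam_sub_mean_le` — ONE STEP: the logarithmic velocity of the average (78) of [5] at a `U1`-valued point whose block
  quantities satisfy `‖W_x − 1‖ ≤ ε ≤ 1/8` differs from the block mean of the velocities by `≤ 22·ε·max_x‖λ(x) − λ(y)‖` — the
  defects `(D log)_W(·W) − 1`, `Φ_S − 1` are `O(ε)` (`B7Prop3GeneralLinearBound.norm_Dmlog_mul_right_sub_self_le`,
  `norm_PhiY_sub_self_le`, BY NAME) and the two conjugations `Ad_{g(y)}^{±1}` cancel on the main term.
* §2 oscillations: `OscBd f a` (nearest-neighbour oscillation `≤ a`) ⇒ `‖f(y + r) − f(y)‖ ≤ dL·a` on blocks (tree contours of [5],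
  `B7Prop1Explicit.treeWord`), `‖f(x + n e_κ) − f(x)‖ ≤ n·a`.
* §3 THE TOWER: along the levels `l ≤ j` of [5] (79)–(80) at `U₀ = 1`, for `U` with `U1`-valued level averages and the regularity
  (167) of [5] `‖Ūˡ(Lz)⁻¹Ūˡ(Lz + r) − 1‖ ≤ αL^{l+1}η` (`B7Eq167Flat.Cond167 L 1 U j α η` — NO smallness of `U − 1`: a chiral
  background is not near the identity) and `88(d+1)αLʲη ≤ 1`:
  `‖lamTower L U μ l y − (Q′_l μ)(y)‖ ≤ 88·d·α·ω·η·L^{2l}` and `OscBd (lamTower L U μ l) (Lˡω·e^{88dαLˡη})` (`tower_bounds`),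
  `ω` = the nearest-neighbour oscillation of `μ` (`Q′_l = B7Eq214Flat.lamAvg L l`, the block means).
File 3 (`B9Eq3194Smallness`) turns `tower_bounds` at `l = j` into (3.194)'s «F_{2,j}(U) is small»:
`‖F_{2,j}(U)A(y)‖ ≤ 88·d·α·ω(A)·η·L^{2j}`.
READINGS / DIVERGENCES.  (a) «regular background field U» = (167) of [5] for `u₁ = U` at `U₀ = 1` (slow variation of the level
averages), the class in which the averages (78)–(80) are defined ([5] p. 44); (b) the constants `22`, `44`, `88d` and the invariant
shapes are this lineage's (print gives none); (c) `ℤ^d` carriers, Banach `U1` reading of `G`-valued.  Unit `lit-balaban-p05` gen 4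
(literature-prover-lit-balaban-p05-g4-0); Phase-2 row `B9.App` (owner r06, referee ref-4); HOME `run/shared/lean/pub/lit-balaban/`.
v1.1 DOCFIX (unit `lit-balaban-p05` gen 24, literature-prover-lit-balaban-p05-g24-0, 2026-08-23): the [Balaban1985Averaging]
locator of `norm_Sexp_le` «(26) p.21» → «(26) p.22» (r04 gen 22 `CITELOC-AUDIT-g22.md` §2 row `lit-balaban-p05`; re-read on the held
text layer `paper:balaban1985-cmp98-averaging` p0005/p0006 and the ×2 render `pub-balaban/b2b-balaban-ref1/pages/1985-cmp98-averaging/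
1985-cmp98-averaging-p006-x2.png`: (24)–(25) close p. 21; p. 22 opens «We will need also inequalities of this type for arbitrary
complex matrices X instead of U. For matrices X satisfying |X − 1| ≦ ½, we have |log X| ≦ Σ_{n≥1} (1/n)|X − 1|ⁿ ≦ |X − 1|/(1 − |X − 1|)
≦ 2|X − 1|, (26)»); every other locator of this file re-checked against the same layer (r04՚s verified display→page map) and
CMP 99 p0045 ((3.194) p. 433) — no further slip; docstring-only change, every declaration byte-identical to v1 (p250943).
NOT summit progress.
-/

noncomputable section

open NormedSpace Finset Complex

namespace Literature.MathematicalPhysics.QuantumFieldTheory.Balaban1983to89.B9Eq3194LinearTerm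

open B7Prop1Explicit MatrixLog B7Eq99Concrete B7Eq84Concrete B7Eq92Concrete
open B7Eq170Flat (bmean bmean_apply bmean_const bmean_add bmean_cj cj cj_apply norm_bmean_le)
open B7Eq214Flat (lamAvg lamAvg_zero lamAvg_succ bmean_sub)
open B7Eq167Flat (Cond167)
open B7Prop8Flat (cond167_one_left_iff)
open B12AverageCorridor267 (Dmlog Dexp PhiY PhiY_apply AdU AdU_apply Dmlog_one Dexp_zero norm_AdU_le_one)
open B7Prop3GeneralLinearBound (norm_Dmlog_mul_right_sub_self_le norm_PhiY_sub_self_le)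
open B9Eq3194Derivative

-- `Site` alone would resolve to the torus sites of `Setup.lean`; re-export the `ℤ^d` sites of `B7Prop1Explicit`.
export B7Prop1Explicit (Site)

variable {d : ℕ}

variable {𝔸 : Type*} [NormedRing 𝔸] [NormedAlgebra ℂ 𝔸] [NormOneClass 𝔸] [CompleteSpace 𝔸]

/-! ## §1 One step: the logarithmic velocity of (78) is the block mean of the velocities up to `O(ε)` -/

section OneStep

variable (L : ℕ)

omit [NormOneClass 𝔸] [CompleteSpace 𝔸] in
/-- `Ad_P` is the conjugation `cj` of `B7Eq170Flat`. [cite: Balaban1985Averaging, (56) p.27] -/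
theorem AdU_eq_cj (P : 𝔸ˣ) (X : 𝔸) : AdU P X = cj P X := by
  rw [AdU_apply, cj_apply]

omit [NormOneClass 𝔸] [CompleteSpace 𝔸] in
/-- `Ad_P Ad_{P⁻¹} = 1`. [cite: Balaban1985Averaging, (56) p.27] -/
theorem AdU_AdU_inv (P : 𝔸ˣ) (X : 𝔸) : AdU P (AdU P⁻¹ X) = X := by
  rw [AdU_apply, AdU_apply, inv_inv]
  calc (P : 𝔸) * (((P⁻¹ : 𝔸ˣ) : 𝔸) * X * (P : 𝔸)) * ((P⁻¹ : 𝔸ˣ) : 𝔸)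
      = ((P : 𝔸) * ((P⁻¹ : 𝔸ˣ) : 𝔸)) * X * ((P : 𝔸) * ((P⁻¹ : 𝔸ˣ) : 𝔸)) := by noncomm_ring
    _ = X := by rw [Units.mul_inv, one_mul, mul_one]

omit [CompleteSpace 𝔸] in
/-- `‖Ad_P X‖ ≤ ‖X‖` for `P ∈ U1`. [cite: Balaban1985Averaging, (57) p.27] -/
theorem norm_AdU_le_of_mem_U1 {P : 𝔸ˣ} (hP : P ∈ U1 𝔸) (X : 𝔸) : ‖AdU P X‖ ≤ ‖X‖ :=
  (ContinuousLinearMap.le_opNorm _ _).trans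
    ((mul_le_mul_of_nonneg_right (norm_AdU_le_one (mem_U1.1 hP).1 (mem_U1.1 hP).2) (norm_nonneg _)).trans (one_mul _).le)

omit [NormOneClass 𝔸] in
/-- The exponent of (78) is `O(ε)`: `‖Σ_x L^{−d} log W_x‖ ≤ 2ε` for `‖W_x − 1‖ ≤ ε ≤ 1/2` ((26) of [5], `norm_mlog_le_two_mul`).
[cite: Balaban1985Averaging, (78) p.30, (26) p.22] -/
theorem norm_Sexp_le (hL : 1 ≤ L) {g : Site d → 𝔸ˣ} {y : Site d} {ε : ℝ} (hε : ε ≤ 1 / 2)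
    (hW : ∀ r : Fin d → Fin L, ‖((Wr L g y r : 𝔸ˣ) : 𝔸) - 1‖ ≤ ε) : ‖Sexp L g y‖ ≤ 2 * ε := by
  rw [Sexp_eq_sum_Wr, ← bmean_apply]
  exact norm_bmean_le hL fun r => (norm_mlog_le_two_mul ((hW r).trans hε)).trans (by linarith [hW r])

omit [NormOneClass 𝔸] [CompleteSpace 𝔸] in
/-- `Σ_x L^{−d} f(x) = c + Σ_x L^{−d}(f(x) − c)` (the weights sum to one). [cite: Balaban1985Averaging, (78) p.30] -/
theorem bmean_eq_add_bmean_sub (hL : 1 ≤ L) (f : (Fin d → Fin L) → 𝔸) (c : 𝔸) :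
    bmean L f = c + bmean L (fun r => f r - c) := by
  rw [show (fun r => f r - c) = fun r => f r - (fun _ : Fin d → Fin L => c) r from rfl, bmean_sub, bmean_const hL]
  abel

/-- **ONE STEP OF (78) LINEARISED AT A GENERAL REGULAR POINT: the defect is `O(ε)`.**  For a `U1`-valued `g` on the block of `y`
with `‖g(y)⁻¹g(x) − 1‖ ≤ ε ≤ 1/8` and velocities `λ` with `‖λ(x) − λ(y)‖ ≤ m` on the block:
`‖stepLam L g λ y − Σ_x L^{−d}λ(x)‖ ≤ 22·ε·m` — the operators `(D log)_{W_x}(·W_x)` and `Φ_S` are `1 + O(ε)` ([5] p. 36 "equal to 1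
for z = 0", the tree's `norm_Dmlog_mul_right_sub_self_le` (`6ε`), `norm_PhiY_sub_self_le` (`8ε`, `‖S‖ ≤ 2ε`)), and
`Ad_{g(y)}Ad_{g(y)⁻¹} = 1` on the main term. This is print's «the operator F_{2,j}(U) is small» for one averaging step.
[cite: Balaban1985BackgroundPropagators, (3.194) p.433] [cite: Balaban1985Averaging, (78) p.30, (124)–(126) p.36] -/
theorem norm_stepLam_sub_mean_le (hL : 1 ≤ L) {g : Site d → 𝔸ˣ} {lam : Site d → 𝔸} {y : Site d} {ε m : ℝ}
    (hgy : g y ∈ U1 𝔸) (hg : ∀ r : Fin d → Fin L, g (y + boxVec L r) ∈ U1 𝔸) (hε0 : 0 ≤ ε) (hε : ε ≤ 1 / 8)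
    (hW : ∀ r : Fin d → Fin L, ‖((Wr L g y r : 𝔸ˣ) : 𝔸) - 1‖ ≤ ε)
    (hm : ∀ r : Fin d → Fin L, ‖lam (y + boxVec L r) - lam y‖ ≤ m) :
    ‖stepLam L g lam y - bmean L (fun r => lam (y + boxVec L r))‖ ≤ 22 * ε * m := by
  have hm0 : 0 ≤ m := (norm_nonneg _).trans (hm fun _ => ⟨0, hL⟩)
  -- the block pieces
  set δ : (Fin d → Fin L) → 𝔸 := fun r => lam (y + boxVec L r) - lam y with hδ
  set Z : (Fin d → Fin L) → 𝔸 := fun r => AdU (g y)⁻¹ (δ r) with hZ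
  set T : (Fin d → Fin L) → 𝔸 := fun r =>
    Dmlog ((Wr L g y r : 𝔸ˣ) : 𝔸) (Z r * ((Wr L g y r : 𝔸ˣ) : 𝔸)) with hT
  have hWU : ∀ r, Wr L g y r ∈ U1 𝔸 := fun r => (U1 𝔸).mul_mem ((U1 𝔸).inv_mem hgy) (hg r)
  have hZle : ∀ r, ‖Z r‖ ≤ m := fun r => (norm_AdU_le_of_mem_U1 ((U1 𝔸).inv_mem hgy) _).trans (hm r)
  have hTZ : ∀ r, ‖T r - Z r‖ ≤ 6 * ε * m := fun r =>
    (norm_Dmlog_mul_right_sub_self_le (hWU r) hε0 hε (hW r) (Z r)).trans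
      (mul_le_mul_of_nonneg_left (hZle r) (by positivity))
  have hTle : ∀ r, ‖T r‖ ≤ 2 * m := by
    intro r
    calc ‖T r‖ = ‖(T r - Z r) + Z r‖ := by rw [sub_add_cancel]
      _ ≤ 6 * ε * m + m := (norm_add_le _ _).trans (add_le_add (hTZ r) (hZle r))
      _ ≤ 2 * m := by nlinarith
  -- the exponent, its derivative and the exponential factor
  have hdS : dSexp L g lam y = bmean L T := rfl
  have hS : ‖Sexp L g y‖ ≤ 2 * ε := norm_Sexp_le L hL (hε.trans (by norm_num)) hW
  have hdSM : ‖dSexp L g lam y - bmean L Z‖ ≤ 6 * ε * m := by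
    rw [hdS, ← bmean_sub]
    exact norm_bmean_le hL fun r => hTZ r
  have hdSle : ‖dSexp L g lam y‖ ≤ 2 * m := by
    rw [hdS]; exact norm_bmean_le hL hTle
  have hP : ‖PhiY (Sexp L g y) (dSexp L g lam y) - dSexp L g lam y‖ ≤ 16 * ε * m :=
    (norm_PhiY_sub_self_le hS hε _).trans (by nlinarith)
  -- the main term: `Ad_{g(y)} (Σ w Ad_{g(y)⁻¹} δ) = Σ w δ` and `Σ w λ(x) = λ(y) + Σ w δ`
  have hmain : AdU (g y) (bmean L Z) = bmean L δ := by
    rw [AdU_eq_cj, ← bmean_cj]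
    congr 1
    funext r
    rw [← AdU_eq_cj, hZ, AdU_AdU_inv]
  have hmean : bmean L (fun r => lam (y + boxVec L r)) = lam y + bmean L δ :=
    bmean_eq_add_bmean_sub L hL _ (lam y)
  -- assemble
  have hsplit : stepLam L g lam y - bmean L (fun r => lam (y + boxVec L r))
      = AdU (g y) ((PhiY (Sexp L g y) (dSexp L g lam y) - dSexp L g lam y) + (dSexp L g lam y - bmean L Z)) := by
    rw [stepLam, hmean, sub_add_sub_cancel, map_sub, hmain]
    abel
  rw [hsplit]
  calc ‖AdU (g y) ((PhiY (Sexp L g y) (dSexp L g lam y) - dSexp L g lam y) + (dSexp L g lam y - bmean L Z))‖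
      ≤ ‖(PhiY (Sexp L g y) (dSexp L g lam y) - dSexp L g lam y) + (dSexp L g lam y - bmean L Z)‖ :=
        norm_AdU_le_of_mem_U1 hgy _
    _ ≤ 16 * ε * m + 6 * ε * m := (norm_add_le _ _).trans (add_le_add hP hdSM)
    _ = 22 * ε * m := by ring

end OneStep

/-! ## §2 Oscillations on the lattice -/

section Oscillation

omit [NormedAlgebra ℂ 𝔸] [NormOneClass 𝔸] [CompleteSpace 𝔸]

/-- Nearest-neighbour oscillation bound of a site function: `‖f(x + e_κ) − f(x)‖ ≤ a` (the `η|∂f|` of [5] (207) on the `ℤ^d`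
carrier). [cite: Balaban1985Averaging, (207) p.50] -/
def OscBd (f : Site d → 𝔸) (a : ℝ) : Prop := ∀ (x : Site d) (κ : Fin d), ‖f (x + e κ) - f x‖ ≤ a

/-- The oscillation bound is monotone in the constant. [cite: Balaban1985Averaging, (207) p.50] -/
theorem OscBd.mono {f : Site d → 𝔸} {a b : ℝ} (h : OscBd f a) (hab : a ≤ b) : OscBd f b := fun x κ => (h x κ).trans hab

/-- Telescoping along a lattice word: `‖f(x + Γ) − f(x)‖ ≤ |Γ|·a`. [cite: Balaban1985Averaging, (207) p.50, p.24 (tree contours)] -/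
theorem norm_sub_le_of_word {f : Site d → 𝔸} {a : ℝ} (hf : OscBd f a) :
    ∀ (w : List (Letter d)) (x : Site d), ‖f (x + disp w) - f x‖ ≤ w.length * a
  | [], x => by simp
  | l :: w, x => by
    have ih := norm_sub_le_of_word hf w (x + l.vec)
    have hstep : ‖f (x + l.vec) - f x‖ ≤ a := by
      obtain ⟨κ, b⟩ := l
      cases b
      · have h := hf (x - e κ) κ
        rw [sub_add_cancel] at h
        rw [Letter.vec_false, ← sub_eq_add_neg, ← norm_neg, neg_sub]
        exact h
      · rw [Letter.vec_true]
        exact hf x κ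
    rw [disp_cons, ← add_assoc, List.length_cons, Nat.cast_succ, add_mul, one_mul]
    calc ‖f (x + l.vec + disp w) - f x‖
        = ‖(f (x + l.vec + disp w) - f (x + l.vec)) + (f (x + l.vec) - f x)‖ := by rw [sub_add_sub_cancel]
      _ ≤ w.length * a + a := (norm_add_le _ _).trans (add_le_add ih hstep)

/-- On a block: `‖f(y + r) − f(y)‖ ≤ dL·a`, `r ∈ [0, L)^d` (the tree contour `Γ_{y,y+r}` has `≤ d(L−1)` bonds,
`B7Prop1Explicit.l1_boxVec_le`). [cite: Balaban1985Averaging, (207) p.50, (2) p.17] -/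
theorem norm_sub_le_block (L : ℕ) {f : Site d → 𝔸} {a : ℝ} (hf : OscBd f a) (ha : 0 ≤ a) (y : Site d) (r : Fin d → Fin L) :
    ‖f (y + boxVec L r) - f y‖ ≤ d * L * a := by
  have h := norm_sub_le_of_word hf (treeWord (boxVec L r)) y
  rw [disp_treeWord, length_treeWord] at h
  refine h.trans (mul_le_mul_of_nonneg_right ?_ ha)
  exact_mod_cast l1_boxVec_le L r

/-- Along an axis: `‖f(x + n e_κ) − f(x)‖ ≤ n·a`. [cite: Balaban1985Averaging, (207) p.50] -/
theorem norm_sub_le_nsmul {f : Site d → 𝔸} {a : ℝ} (hf : OscBd f a) (x : Site d) (κ : Fin d) :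
    ∀ n : ℕ, ‖f (x + (n : ℤ) • e κ) - f x‖ ≤ n * a
  | 0 => by simp
  | n + 1 => by
    have ih := norm_sub_le_nsmul hf x κ n
    have hstep := hf (x + (n : ℤ) • e κ) κ
    rw [Nat.cast_succ, add_smul, one_smul, ← add_assoc, Nat.cast_succ, add_mul, one_mul]
    calc ‖f (x + (n : ℤ) • e κ + e κ) - f x‖
        = ‖(f (x + (n : ℤ) • e κ + e κ) - f (x + (n : ℤ) • e κ)) + (f (x + (n : ℤ) • e κ) - f x)‖ := by
          rw [sub_add_sub_cancel]
      _ ≤ a + n * a := (norm_add_le _ _).trans (add_le_add hstep ih)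
      _ = n * a + a := add_comm _ _

end Oscillation

/-! ## §3 The tower: level by level -/

section Tower

variable (L : ℕ)

omit [NormOneClass 𝔸] in
/-- The error of one level: `λ_{l+1}(z) − (Q′-step)` with the mean of `λ_l` over the block of `Lz`.
[cite: Balaban1985BackgroundPropagators, (3.194) p.433] -/
theorem lamTower_succ_sub (U : Site d → 𝔸ˣ) (μ : Site d → 𝔸) (l : ℕ) (z : Site d) :
    lamTower L U μ (l + 1) z - lamAvg L (l + 1) μ z
      = (stepLam L (uavg L 1 U l) (lamTower L U μ l) ((L : ℤ) • z)
          - bmean L (fun r => lamTower L U μ l ((L : ℤ) • z + boxVec L r)))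
        + bmean L (fun r => lamTower L U μ l ((L : ℤ) • z + boxVec L r) - lamAvg L l μ ((L : ℤ) • z + boxVec L r)) := by
  rw [lamTower_succ, lamAvg_succ, bmean_sub, sub_add_sub_cancel]

/-- **One level of the tower**: if the level-`l` velocities are within `f` of `Q′_lμ` and have oscillation `≤ a`, the background
level `Ūˡ` is `U1`-valued with (167)-quantities `≤ ε ≤ 1/8`, then at level `l+1` the velocities are within `f + 22ε·dL·a` of
`Q′_{l+1}μ` and have oscillation `≤ L·a + 44ε·dL·a`. [cite: Balaban1985BackgroundPropagators, (3.194) p.433]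
[cite: Balaban1985Averaging, (78)–(80) p.30, (167) p.44] -/
theorem level_step (hL : 1 ≤ L) {U : Site d → 𝔸ˣ} {μ : Site d → 𝔸} {l : ℕ} {ε f a : ℝ}
    (hV : ∀ x, uavg L 1 U l x ∈ U1 𝔸) (hε0 : 0 ≤ ε) (hε : ε ≤ 1 / 8)
    (hW : ∀ (z : Site d) (r : Fin d → Fin L), ‖((Wr L (uavg L 1 U l) ((L : ℤ) • z) r : 𝔸ˣ) : 𝔸) - 1‖ ≤ ε)
    (hf : ∀ y, ‖lamTower L U μ l y - lamAvg L l μ y‖ ≤ f) (ha : 0 ≤ a) (hosc : OscBd (lamTower L U μ l) a) :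
    (∀ z, ‖lamTower L U μ (l + 1) z - lamAvg L (l + 1) μ z‖ ≤ f + 22 * ε * (d * L * a)) ∧
      OscBd (lamTower L U μ (l + 1)) (L * a + 44 * ε * (d * L * a)) := by
  -- the one-step defect at every coarse site
  have hE : ∀ z : Site d, ‖stepLam L (uavg L 1 U l) (lamTower L U μ l) ((L : ℤ) • z)
      - bmean L (fun r => lamTower L U μ l ((L : ℤ) • z + boxVec L r))‖ ≤ 22 * ε * (d * L * a) := fun z =>
    norm_stepLam_sub_mean_le L hL (hV _) (fun r => hV _) hε0 hε (hW z) fun r => norm_sub_le_block L hosc ha _ r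
  refine ⟨fun z => ?_, fun z κ => ?_⟩
  · rw [lamTower_succ_sub]
    calc _ ≤ ‖stepLam L (uavg L 1 U l) (lamTower L U μ l) ((L : ℤ) • z)
              - bmean L (fun r => lamTower L U μ l ((L : ℤ) • z + boxVec L r))‖
            + ‖bmean L (fun r => lamTower L U μ l ((L : ℤ) • z + boxVec L r) - lamAvg L l μ ((L : ℤ) • z + boxVec L r))‖ :=
          norm_add_le _ _
      _ ≤ 22 * ε * (d * L * a) + f := add_le_add (hE z) (norm_bmean_le hL fun r => hf _)
      _ = f + 22 * ε * (d * L * a) := add_comm _ _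
  · -- oscillation at level `l+1`: two defects and the shifted block means
    have hshift : ∀ r : Fin d → Fin L,
        ‖lamTower L U μ l ((L : ℤ) • (z + e κ) + boxVec L r) - lamTower L U μ l ((L : ℤ) • z + boxVec L r)‖ ≤ L * a := by
      intro r
      have hrw : (L : ℤ) • (z + e κ) + boxVec L r = ((L : ℤ) • z + boxVec L r) + ((L : ℕ) : ℤ) • e κ := by
        rw [smul_add]; abel
      rw [hrw]
      exact norm_sub_le_nsmul hosc _ κ L
    rw [lamTower_succ, lamTower_succ]
    have key : stepLam L (uavg L 1 U l) (lamTower L U μ l) ((L : ℤ) • (z + e κ))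
          - stepLam L (uavg L 1 U l) (lamTower L U μ l) ((L : ℤ) • z)
        = ((stepLam L (uavg L 1 U l) (lamTower L U μ l) ((L : ℤ) • (z + e κ))
              - bmean L (fun r => lamTower L U μ l ((L : ℤ) • (z + e κ) + boxVec L r)))
            - (stepLam L (uavg L 1 U l) (lamTower L U μ l) ((L : ℤ) • z)
              - bmean L (fun r => lamTower L U μ l ((L : ℤ) • z + boxVec L r))))
          + bmean L (fun r => lamTower L U μ l ((L : ℤ) • (z + e κ) + boxVec L r)
              - lamTower L U μ l ((L : ℤ) • z + boxVec L r)) := by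
      rw [bmean_sub]; abel
    rw [key]
    calc _ ≤ ‖(stepLam L (uavg L 1 U l) (lamTower L U μ l) ((L : ℤ) • (z + e κ))
              - bmean L (fun r => lamTower L U μ l ((L : ℤ) • (z + e κ) + boxVec L r)))
            - (stepLam L (uavg L 1 U l) (lamTower L U μ l) ((L : ℤ) • z)
              - bmean L (fun r => lamTower L U μ l ((L : ℤ) • z + boxVec L r)))‖
          + ‖bmean L (fun r => lamTower L U μ l ((L : ℤ) • (z + e κ) + boxVec L r)
              - lamTower L U μ l ((L : ℤ) • z + boxVec L r))‖ := norm_add_le _ _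
      _ ≤ (22 * ε * (d * L * a) + 22 * ε * (d * L * a)) + L * a :=
          add_le_add ((norm_sub_le _ _).trans (add_le_add (hE _) (hE _))) (norm_bmean_le hL hshift)
      _ = L * a + 44 * ε * (d * L * a) := by ring

/-- **THE TOWER BOUNDS.**  For a background `U` whose level averages `Ūˡ = uavg L 1 U l`, `l < j`, are `U1`-valued and satisfy the
regularity (167) of [5] at `U₀ = 1` with constant `α` (`B7Eq167Flat.Cond167 L 1 U j α η`), `L ≥ 2`, `88(d+1)·αLʲη ≤ 1`, and a
direction field `μ` of nearest-neighbour oscillation `≤ ω`: for every `l ≤ j`,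
`‖lamTower L U μ l y − (Q′_lμ)(y)‖ ≤ 88·d·α·ω·η·L^{2l}` and `OscBd (lamTower L U μ l) (Lˡ·ω·e^{88dαLˡη})` — induction on the
levels with `level_step` (the invariants close because `L ≥ 2`: `88dαLˡη + 44dαL^{l+1}η ≤ 88dαL^{l+1}η`, `88/L² + 66 ≤ 88`).
[cite: Balaban1985BackgroundPropagators, (3.194) p.433] [cite: Balaban1985Averaging, (79)–(80) p.30, (167) p.44] -/
theorem tower_bounds (hL : 2 ≤ L) {U : Site d → 𝔸ˣ} {μ : Site d → 𝔸} {j : ℕ} {α η ω : ℝ}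
    (hV : ∀ l < j, ∀ x, uavg L 1 U l x ∈ U1 𝔸) (h167 : Cond167 L 1 U j α η)
    (hα : 0 ≤ α) (hη : 0 ≤ η) (hs : 88 * ((d : ℝ) + 1) * (α * (L : ℝ) ^ j * η) ≤ 1)
    (hω : 0 ≤ ω) (hμ : OscBd μ ω) :
    ∀ l ≤ j, (∀ y, ‖lamTower L U μ l y - lamAvg L l μ y‖ ≤ 88 * d * α * ω * η * (L : ℝ) ^ (2 * l)) ∧
      OscBd (lamTower L U μ l) ((L : ℝ) ^ l * ω * Real.exp (88 * d * (α * (L : ℝ) ^ l * η))) := by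
  have hL1 : 1 ≤ L := le_trans (by norm_num) hL
  have hLr : (2 : ℝ) ≤ L := by exact_mod_cast hL
  have hd : (0 : ℝ) ≤ d := Nat.cast_nonneg d
  have hxj0 : 0 ≤ α * (L : ℝ) ^ j * η := by positivity
  have hxj : 88 * (α * (L : ℝ) ^ j * η) ≤ 1 := by nlinarith
  rw [cond167_one_left_iff] at h167
  intro l
  induction l with
  | zero =>
    intro _
    refine ⟨fun y => ?_, fun x κ => ?_⟩
    · rw [lamTower_zero, lamAvg_zero, sub_self, norm_zero]
      positivity
    · rw [lamTower_zero, pow_zero, one_mul]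
      exact (hμ x κ).trans (le_mul_of_one_le_right hω (Real.one_le_exp (by positivity)))
  | succ l ih =>
    intro hl
    have hll : l < j := Nat.lt_of_succ_le hl
    obtain ⟨hf, hosc⟩ := ih hll.le
    -- the level constants
    set ε : ℝ := α * (L : ℝ) ^ (l + 1) * η with hεdef
    set a : ℝ := (L : ℝ) ^ l * ω * Real.exp (88 * d * (α * (L : ℝ) ^ l * η)) with hadef
    have hε0 : 0 ≤ ε := by positivity
    have hpow : (L : ℝ) ^ (l + 1) ≤ (L : ℝ) ^ j := pow_le_pow_right₀ (by linarith) hl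
    have hpow' : (L : ℝ) ^ l ≤ (L : ℝ) ^ j := pow_le_pow_right₀ (by linarith) hll.le
    have hεj : ε ≤ α * (L : ℝ) ^ j * η := mul_le_mul_of_nonneg_right (mul_le_mul_of_nonneg_left hpow hα) hη
    have hxl : α * (L : ℝ) ^ l * η ≤ α * (L : ℝ) ^ j * η :=
      mul_le_mul_of_nonneg_right (mul_le_mul_of_nonneg_left hpow' hα) hη
    have hε8 : ε ≤ 1 / 8 := by linarith
    have ha0 : 0 ≤ a := by positivity
    have hW : ∀ (z : Site d) (r : Fin d → Fin L), ‖((Wr L (uavg L 1 U l) ((L : ℤ) • z) r : 𝔸ˣ) : 𝔸) - 1‖ ≤ ε :=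
      fun z r => h167 l hll z r
    obtain ⟨hf', hosc'⟩ := level_step L hL1 (hV l hll) hε0 hε8 hW hf ha0 hosc
    refine ⟨fun y => (hf' y).trans ?_, hosc'.mono ?_⟩
    · -- `88dαωηL^{2l} + 22ε·dL·a ≤ 88dαωηL^{2(l+1)}`
      have hexp : Real.exp (88 * d * (α * (L : ℝ) ^ l * η)) ≤ 3 := by
        have hle : 88 * d * (α * (L : ℝ) ^ l * η) ≤ 1 := by
          have h0 : 0 ≤ α * (L : ℝ) ^ l * η := by positivity
          nlinarith
        calc Real.exp (88 * d * (α * (L : ℝ) ^ l * η)) ≤ Real.exp 1 := Real.exp_le_exp.2 hle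
          _ ≤ 3 := by have := Real.exp_one_lt_d9; linarith
      have ha3 : a ≤ 3 * ((L : ℝ) ^ l * ω) := by
        rw [hadef]
        calc (L : ℝ) ^ l * ω * Real.exp (88 * d * (α * (L : ℝ) ^ l * η)) ≤ (L : ℝ) ^ l * ω * 3 :=
              mul_le_mul_of_nonneg_left hexp (by positivity)
          _ = 3 * ((L : ℝ) ^ l * ω) := by ring
      have h1 : 22 * ε * (d * L * a) ≤ 66 * d * α * ω * η * (L : ℝ) ^ (2 * (l + 1)) := by
        have h := mul_le_mul_of_nonneg_left (mul_le_mul_of_nonneg_left ha3 (by positivity : (0 : ℝ) ≤ d * L))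
          (by positivity : (0 : ℝ) ≤ 22 * ε)
        refine h.trans (le_of_eq ?_)
        rw [hεdef]
        ring
      have h2 : 88 * d * α * ω * η * (L : ℝ) ^ (2 * l) ≤ 22 * d * α * ω * η * (L : ℝ) ^ (2 * (l + 1)) := by
        have hL4 : (4 : ℝ) ≤ (L : ℝ) ^ 2 := by nlinarith
        have e2 : (L : ℝ) ^ (2 * (l + 1)) = (L : ℝ) ^ (2 * l) * (L : ℝ) ^ 2 := by ring
        rw [e2]
        have h0 : 0 ≤ d * α * ω * η * (L : ℝ) ^ (2 * l) := by positivity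
        nlinarith
      linarith
    · -- `L·a + 44ε·dL·a ≤ L^{l+1}·ω·e^{88dαL^{l+1}η}`
      have h1 : (L : ℝ) * a + 44 * ε * (d * L * a) = (L : ℝ) * a * (1 + 44 * d * ε) := by ring
      have h2 : 1 + 44 * d * ε ≤ Real.exp (44 * d * ε) := by
        have := Real.add_one_le_exp (44 * d * ε); linarith
      have h3 : 88 * d * (α * (L : ℝ) ^ l * η) + 44 * d * ε ≤ 88 * d * (α * (L : ℝ) ^ (l + 1) * η) := by
        rw [hεdef, pow_succ]
        have h0 : 0 ≤ d * (α * (L : ℝ) ^ l * η) := by positivity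
        nlinarith
      rw [h1]
      calc (L : ℝ) * a * (1 + 44 * d * ε) ≤ (L : ℝ) * a * Real.exp (44 * d * ε) :=
            mul_le_mul_of_nonneg_left h2 (by positivity)
        _ = (L : ℝ) ^ (l + 1) * ω * (Real.exp (88 * d * (α * (L : ℝ) ^ l * η)) * Real.exp (44 * d * ε)) := by
            rw [hadef]; ring
        _ = (L : ℝ) ^ (l + 1) * ω * Real.exp (88 * d * (α * (L : ℝ) ^ l * η) + 44 * d * ε) := by rw [Real.exp_add]
        _ ≤ (L : ℝ) ^ (l + 1) * ω * Real.exp (88 * d * (α * (L : ℝ) ^ (l + 1) * η)) :=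
            mul_le_mul_of_nonneg_left (Real.exp_le_exp.2 h3) (by positivity)

end Tower

end Literature.MathematicalPhysics.QuantumFieldTheory.Balaban1983to89.B9Eq3194LinearTerm
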